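import Summits.QuantumAdvantage.QuantumAdvantage.Theorems.CubicForrelationNearExactIsExactCubicFormHyperplane
import Summits.QuantumAdvantage.QuantumAdvantage.Theorems.CubicForrelationNearExactIsExactCubicFormSymplecticCoords
import Summits.QuantumAdvantage.QuantumAdvantage.Theorems.CubicForrelationNearExactIsExactCubicFormFrameK

/-!
# Crux `CubicForrelation.NearExactIsExact` (stmt-QuantumAdvantage-14043) — the LIGHT CELL IN COORDINATES: `t̄ = s₀ ∧ ω_{2h}`

Certificate seat `b2b-cforr-cert` (gen 41).  HONEST FRAMING: kernel-checked assembly (standard axioms) — the keystone of step (4) of the Lean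
roadmap for `E1280-even` (HOME/b2b-cforr-cert-g40/LEAN-PLAN-E1280-EVEN.md §2 (f)–(g), §4): given the data produced by …CubicFormLightCell
`tlc_light_frame` for a hyperplane-supported cubic `ρ` (direction `v`, quadratic `q = ρ ⊕ ρ(·⊕v)` with base-point free form `B`, a maximal
symplectic frame `(bᵢ, cᵢ)_{i<h}` of `B` in `ker z` with `v` radical), there is an invertible `P` over `𝔽₂` such that the cubic form of `ρ` on
the frame directions `P y, P y', P y''` is `y₀·ω(y',y'') ⊕ y'₀·ω(y,y'') ⊕ y''₀·ω(y,y')` with `ω(y',y'') = Σᵢ (y'_{1+i} y''_{1+h+i} +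
y'_{1+h+i} y''_{1+i})` — i.e. `t̄ = s₀ ∧ ω_{2h}`, the descendants `T, s₀ω₄, s₀ω₆, s₀ω₈` of the light-cell analysis in coordinates
(…CubicFormHyperplane `tch_third_of_hyperplane` + …CubicFormSymplecticCoords + …CubicFormFrameK).  Nothing about `θ₁₂`; NOT summit progress.

* `tlc_coords`: the statement above; coordinates `0`, `lo i = 1 + i`, `hi i = 1 + h + i` of `Fin n` via `Fin.castLE`.

References: T. Kasami, N. Tokura (1970) Thm 1; L. E. Dickson (1901); F. J. MacWilliams, N. J. A. Sloane (1977) Ch. 15 §2.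
Axioms: the standard three.
-/

set_option linter.dupNamespace false -- D-0017: single-problem summit ⇒ `QuantumAdvantage.QuantumAdvantage` by design

namespace Summit.QuantumAdvantage.QuantumAdvantage.Theorems.CubicForrelation.NearExactIsExact

open Finset
open Literature.Computability.QuantumComplexity
open Literature.Computability.QuantumComplexity.BuzetChailloux (bxor zeroVec bxor_comm bxor_self bxor_zeroVec zeroVec_bxor
  bxor_bxor_cancel_left)

variable {n : ℕ}

/-- **The light cell in coordinates (`t̄ = s₀ ∧ ω_{2h}`).**  See the module docstring. [this work; cite: KasamiTokura1970, Thm 1] -/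
theorem tlc_coords (ρ : (Fin n → Bool) → Bool) (hρ : IsDegLeFun 3 ρ) (z v : Fin n → Bool) (bz : Bool)
    (hsupp : ∀ x, ρ x = true → decide (Odd #(univ.filter fun i => (x i && z i) = true)) = bz)
    (hvz : decide (Odd #(univ.filter fun i => (v i && z i) = true)) = true)
    (q : (Fin n → Bool) → Bool) (hq : ∀ x, q x = (ρ x ^^ ρ (bxor x v)))
    (B : (Fin n → Bool) → (Fin n → Bool) → Bool)
    (hB : ∀ u w x, ((q x ^^ q (bxor x w)) ^^ (q (bxor x u) ^^ q (bxor (bxor x u) w))) = B u w)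
    (h : ℕ) (b c : Fin h → (Fin n → Bool))
    (hbc : ∀ i, B (b i) (c i) = true) (hbc' : ∀ i j, i ≠ j → B (b i) (c j) = false)
    (hbb : ∀ i j, B (b i) (b j) = false) (hcc : ∀ i j, B (c i) (c j) = false)
    (hmax : ∀ x y, (∀ i, B x (b i) = false) → (∀ i, B x (c i) = false) → (∀ i, B y (b i) = false) → (∀ i, B y (c i) = false) →
      B x y = false)
    (hbz : ∀ i, decide (Odd #(univ.filter fun j => (b i j && z j) = true)) = false)
    (hcz : ∀ i, decide (Odd #(univ.filter fun j => (c i j && z j) = true)) = false)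
    (hrad : ∀ w, B v w = false) :
    ∃ (hk : 1 + h + h ≤ n) (P Pi : Fin n → Fin n → ZMod 2),
      (∀ ψ ω, (∑ φ, P ψ φ * Pi φ ω) = if ψ = ω then 1 else 0) ∧
      (∀ ψ ω, (∑ φ, Pi ψ φ * P φ ω) = if ψ = ω then 1 else 0) ∧
      ∀ (y y' y'' x : Fin n → Bool),
        let Pv : (Fin n → Bool) → (Fin n → Bool) :=
          fun y ψ => decide ((∑ φ, P ψ φ * (if y φ = true then (1 : ZMod 2) else 0)) = 1)
        let lo : Fin h → Fin n := fun i => Fin.castLE hk (Fin.castAdd h (Fin.natAdd 1 i))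
        let hi : Fin h → Fin n := fun i => Fin.castLE hk (Fin.natAdd (1 + h) i)
        let Ω : (Fin n → Bool) → (Fin n → Bool) → Bool := fun s t =>
          decide ((∑ i : Fin h, ((if s (lo i) = true then (1 : ZMod 2) else 0) * (if t (hi i) = true then (1 : ZMod 2) else 0) +
            (if s (hi i) = true then (1 : ZMod 2) else 0) * (if t (lo i) = true then (1 : ZMod 2) else 0))) = 1)
        (((ρ x ^^ ρ (bxor x (Pv y''))) ^^ (ρ (bxor x (Pv y')) ^^ ρ (bxor (bxor x (Pv y')) (Pv y'')))) ^^
            ((ρ (bxor x (Pv y)) ^^ ρ (bxor (bxor x (Pv y)) (Pv y''))) ^^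
              (ρ (bxor (bxor x (Pv y)) (Pv y')) ^^ ρ (bxor (bxor (bxor x (Pv y)) (Pv y')) (Pv y''))))) =
          (((y (Fin.castLE hk (Fin.castAdd h (Fin.castAdd h (0 : Fin 1)))) && Ω y' y'') ^^
              (y' (Fin.castLE hk (Fin.castAdd h (Fin.castAdd h (0 : Fin 1)))) && Ω y y'')) ^^
            (y'' (Fin.castLE hk (Fin.castAdd h (Fin.castAdd h (0 : Fin 1)))) && Ω y y')) := by
  classical
  -- symmetric / additive
  have hsymm : ∀ u w, B u w = B w u := by
    intro u w
    rw [← hB u w zeroVec, ← hB w u zeroVec, iw_bxor_assoc, iw_bxor_assoc, bxor_comm u w]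
    cases q zeroVec <;> cases q (bxor zeroVec w) <;> cases q (bxor zeroVec u) <;> cases q (bxor zeroVec (bxor w u)) <;> rfl
  have hadd : ∀ u u' w, B (bxor u u') w = (B u w ^^ B u' w) := by
    intro u u' w
    rw [← hB (bxor u u') w zeroVec, ← hB u w zeroVec, ← hB u' w u]
    simp only [zeroVec_bxor]
    cases q zeroVec <;> cases q w <;> cases q u <;> cases q (bxor u w) <;> cases q (bxor u u') <;>
      cases q (bxor (bxor u u') w) <;> rfl
  have hadd2 : ∀ u w w', B u (bxor w w') = (B u w ^^ B u w') := fun u w w' => by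
    rw [hsymm, hadd, hsymm w u, hsymm w' u]
  -- the parity forms of the frame and the dual family
  set ζc : Fin h → (Fin n → Bool) := fun i l => B (fun l' => decide (l' = l)) (c i) with hζc
  set ζb : Fin h → (Fin n → Bool) := fun i l => B (fun l' => decide (l' = l)) (b i) with hζb
  have hζc' : ∀ i x, decide (Odd #(univ.filter fun j => x j && ζc i j)) = B x (c i) := fun i x =>
    (tsc_additive_parity (fun x => B x (c i)) (fun u u' => hadd u u' (c i)) x).symm
  have hζb' : ∀ i x, decide (Odd #(univ.filter fun j => x j && ζb i j)) = B x (b i) := fun i x =>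
    (tsc_additive_parity (fun x => B x (b i)) (fun u u' => hadd u u' (b i)) x).symm
  set ζ : Fin (1 + h + h) → (Fin n → Bool) := Fin.append (Fin.append ![z] ζc) ζb with hζ
  set υ : Fin (1 + h + h) → (Fin n → Bool) := Fin.append (Fin.append ![v] b) c with hυ
  -- index facts
  have hdual : ∀ a a', decide (Odd #(univ.filter fun j => υ a j && ζ a' j)) = decide (a = a') := by
    intro a a'
    rw [show decide (a = a') = decide (a.val = a'.val) from decide_eq_decide.mpr Fin.ext_iff, hυ, hζ]
    refine Fin.addCases (fun a₁ => ?_) (fun j => ?_) a <;> refine Fin.addCases (fun a₁' => ?_) (fun j' => ?_) a'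
    · -- (1+h) × (1+h)
      refine Fin.addCases (fun o => ?_) (fun i => ?_) a₁ <;> refine Fin.addCases (fun o' => ?_) (fun i' => ?_) a₁'
      · simp only [Fin.append_left, Matrix.cons_val_fin_one, Fin.val_castAdd, Fin.val_eq_zero]
        rw [hvz]; simp
      · simp only [Fin.append_left, Fin.append_right, Matrix.cons_val_fin_one, Fin.val_castAdd, Fin.val_natAdd, Fin.val_eq_zero]
        rw [hζc', hrad]; symm; apply decide_eq_false; omega
      · simp only [Fin.append_left, Fin.append_right, Matrix.cons_val_fin_one, Fin.val_castAdd, Fin.val_natAdd, Fin.val_eq_zero]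
        rw [hbz]; symm; apply decide_eq_false; omega
      · simp only [Fin.append_left, Fin.append_right, Fin.val_castAdd, Fin.val_natAdd]
        rw [hζc']
        by_cases hii : i = i'
        · subst hii; rw [hbc]; symm; exact decide_eq_true rfl
        · rw [hbc' i i' hii]; symm; apply decide_eq_false
          intro e; exact hii (Fin.ext (by omega))
    · -- (1+h) × c-block: the form is `B(·, b_{j'})`
      refine Fin.addCases (fun o => ?_) (fun i => ?_) a₁
      · simp only [Fin.append_left, Fin.append_right, Matrix.cons_val_fin_one, Fin.val_castAdd, Fin.val_natAdd, Fin.val_eq_zero]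
        rw [hζb', hrad]; symm; apply decide_eq_false; omega
      · simp only [Fin.append_left, Fin.append_right, Fin.val_castAdd, Fin.val_natAdd]
        rw [hζb', hbb]; symm; apply decide_eq_false; omega
    · -- c-block × (1+h)
      refine Fin.addCases (fun o' => ?_) (fun i' => ?_) a₁'
      · simp only [Fin.append_left, Fin.append_right, Matrix.cons_val_fin_one, Fin.val_castAdd, Fin.val_natAdd, Fin.val_eq_zero]
        rw [hcz]; symm; apply decide_eq_false; omega
      · simp only [Fin.append_left, Fin.append_right, Fin.val_castAdd, Fin.val_natAdd]
        rw [hζc', hcc]; symm; apply decide_eq_false; omega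
    · -- c-block × c-block: `B(c_j, b_{j'})`
      simp only [Fin.append_right, Fin.val_natAdd]
      rw [hζb', hsymm]
      by_cases hjj : j' = j
      · subst hjj; rw [hbc]; symm; exact decide_eq_true rfl
      · rw [hbc' j' j hjj]; symm; apply decide_eq_false
        intro e; exact hjj (Fin.ext (by omega))
  have hk : 1 + h + h ≤ n := tcg_le_of_dual ζ υ hdual
  obtain ⟨P, Pi, hPPi, hPiP, hfr⟩ := tcg_adapted_frame_le hk ζ υ hdual
  refine ⟨hk, P, Pi, hPPi, hPiP, fun y y' y'' x => ?_⟩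
  intro Pv lo hi Ω
  -- the frame property, read on the three blocks
  have hPz : ∀ y, decide (Odd #(univ.filter fun j => Pv y j && z j)) = y (Fin.castLE hk (Fin.castAdd h (Fin.castAdd h (0 : Fin 1)))) := by
    intro y
    have e := hfr (Fin.castAdd h (Fin.castAdd h (0 : Fin 1))) y
    rw [hζ, Fin.append_left, Fin.append_left] at e
    exact e
  have hPc : ∀ y i, B (Pv y) (c i) = y (lo i) := by
    intro y i
    have e := hfr (Fin.castAdd h (Fin.natAdd 1 i)) y
    rw [hζ, Fin.append_left, Fin.append_right, hζc'] at e
    exact e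
  have hPb : ∀ y i, B (Pv y) (b i) = y (hi i) := by
    intro y i
    have e := hfr (Fin.natAdd (1 + h) i) y
    rw [hζ, Fin.append_right, hζb'] at e
    exact e
  -- `B` on frame directions
  have hΩ : ∀ s t, B (Pv s) (Pv t) = Ω s t := by
    intro s t
    have e := tsc_form_expansion B hsymm hadd h b c hbc hbc' hbb hcc hmax (Pv s) (Pv t)
    simp only [hPc, hPb] at e
    have key : ∀ (a : Bool) (r : ZMod 2), (if a = true then (1 : ZMod 2) else 0) = r → a = decide (r = 1) := by decide
    exact key _ _ e
  -- the cubic form of `ρ` is `z ∧ B`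
  have hT := tch_third_of_hyperplane ρ hρ z v bz hsupp hvz (Pv y) (Pv y') (Pv y'') x
  have hBq : ∀ s t, (((ρ zeroVec ^^ ρ (bxor zeroVec v)) ^^ (ρ (bxor zeroVec t) ^^ ρ (bxor (bxor zeroVec t) v))) ^^
      ((ρ (bxor zeroVec s) ^^ ρ (bxor (bxor zeroVec s) v)) ^^ (ρ (bxor (bxor zeroVec s) t) ^^ ρ (bxor (bxor (bxor zeroVec s) t) v)))) =
      B s t := by
    intro s t
    rw [← hB s t zeroVec, hq, hq, hq, hq]
  simp only [hBq, hPz, hΩ] at hT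
  exact hT

end Summit.QuantumAdvantage.QuantumAdvantage.Theorems.CubicForrelation.NearExactIsExact
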